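import Literature.NumberTheory.EllipticCurves.TateModuleFreeProofs
import Literature.NumberTheory.EllipticCurves.TateModuleProjSurjectiveProofs
import Literature.NumberTheory.EllipticCurves.TateModuleFinrankProofs
import HarnessLib

/-!
# A `ℤ_ℓ`-basis of the Tate module adapted to a point of order `ℓ`
(route `SkinnerWilesDefectOne`, item stmt-Langlands-12922 `FiveIsogenyEllipticCurves`, helper)

For an elliptic curve `E` over a field `K` with `ℓ ≠ 0` in `K` and a geometric point `P ≠ O` of
order `ℓ`, there is a `ℤ_ℓ`-basis `(e₀, e₁)` of `T_ℓ E` whose first vector reduces to `P`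
(`exists_basis_proj_one_eq`): lift `P` to `t ∈ T_ℓ E` (`proj_surjective_of_isAlgClosed_holds`),
note `t ∉ ℓ T_ℓ E` (`ker (T_ℓ E → E[ℓ]) = ℓ T_ℓ E`, `TateModule.p_smul_div`), and extend `t` to a
basis of the free rank-two `ℤ_ℓ`-module `T_ℓ E` (`exists_basis_eq_of_not_dvd`: one coordinate of
`t` is a unit of the local ring `ℤ_ℓ`).  In such a basis the matrices of the Galois action are
upper triangular modulo `ℓ` as soon as the line `⟨P⟩ ⊆ E[ℓ]` is Galois stable
(`norm_repr_one_lt_one_of_smul_proj_eq`), which is the residually reducible frame of the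
headline corollary.

References: J. H. Silverman, *The Arithmetic of Elliptic Curves* (2009), III.§7 (the Tate module,
`T_ℓ E / ℓ T_ℓ E = E[ℓ]`); J.-P. Serre, *Abelian ℓ-adic representations and elliptic curves*
(1968), Ch. I §1.1.
-/

noncomputable section

-- `Summit.Langlands.Langlands.…`: summit = sub-problem name (D-0017 layout), as in every Theorems file here.
set_option linter.dupNamespace false

open Literature.NumberTheory.EllipticCurves Literature.NumberTheory.EllipticCurves.TateModule

namespace Summit.Langlands.Langlands.Theorems.FiveIsogenyEllipticCurves

universe u

/-! ### Extending a vector with a unit coordinate to a basis (rank two, any commutative ring) -/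

section Basis

variable {R : Type*} [CommRing R] {M : Type*} [AddCommGroup M] [Module R M]

/-- **A vector with a unit first coordinate extends to a basis.**  If `b = (b₀, b₁)` is a basis
of `M` and `t = x b₀ + y b₁` with `x` a unit, then `(t, b₁)` is a basis of `M`. [folklore] -/
theorem exists_basis_eq_of_isUnit_repr_zero (b : Module.Basis (Fin 2) R M) (t : M)
    (hx : IsUnit (b.repr t 0)) : ∃ e : Module.Basis (Fin 2) R M, e 0 = t ∧ e 1 = b 1 := by
  have ht : t = b.repr t 0 • b 0 + b.repr t 1 • b 1 := by
    conv_lhs => rw [← b.sum_repr t]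
    rw [Fin.sum_univ_two]
  have hli : LinearIndependent R ![t, b 1] := by
    rw [LinearIndependent.pair_iff]
    intro s s' hs
    have h0 := congrArg (fun m => b.repr m 0) hs
    have h1 := congrArg (fun m => b.repr m 1) hs
    simp only [map_add, map_smul, Finsupp.coe_add, Finsupp.coe_smul, Pi.add_apply, Pi.smul_apply,
      Module.Basis.repr_self, Finsupp.single_apply, map_zero, Finsupp.coe_zero, Pi.zero_apply,
      smul_eq_mul] at h0 h1
    norm_num at h0 h1
    have hs0 : s = 0 := by
      obtain ⟨u, hu⟩ := hx
      rw [← hu] at h0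
      simpa using congrArg (· * (u⁻¹ : Rˣ).val) h0
    refine ⟨hs0, ?_⟩
    rw [hs0, zero_mul, zero_add] at h1
    exact h1
  have hsp : ⊤ ≤ Submodule.span R (Set.range ![t, b 1]) := by
    rw [← b.span_eq, Submodule.span_le]
    rintro _ ⟨i, rfl⟩
    have h1 : b 1 ∈ Submodule.span R (Set.range ![t, b 1]) :=
      Submodule.subset_span ⟨1, rfl⟩
    have h0 : t ∈ Submodule.span R (Set.range ![t, b 1]) :=
      Submodule.subset_span ⟨0, rfl⟩
    fin_cases i
    · obtain ⟨u, hu⟩ := hx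
      have e : (u⁻¹ : Rˣ) • (t - b.repr t 1 • b 1) = b 0 := by
        have e1 : t - b.repr t 1 • b 1 = u • b 0 := by
          rw [Units.smul_def, hu]
          exact sub_eq_of_eq_add ht
        rw [e1, inv_smul_smul]
      have hmem : (u⁻¹ : Rˣ) • (t - b.repr t 1 • b 1) ∈ Submodule.span R (Set.range ![t, b 1]) := by
        rw [Units.smul_def]
        exact Submodule.smul_mem _ _ (Submodule.sub_mem _ h0 (Submodule.smul_mem _ _ h1))
      rw [e] at hmem
      simpa using hmem
    · exact h1
  exact ⟨Module.Basis.mk hli hsp, by simp [Module.Basis.mk_apply], by simp [Module.Basis.mk_apply]⟩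

/-- Over `ℤ_ℓ`: **an element outside `ℓ M` extends to a basis** of a free rank-two module `M`
(given a basis `b`): one of its two coordinates is a unit of the local ring `ℤ_ℓ`
(`PadicInt.norm_lt_one_iff_dvd`), and `exists_basis_eq_of_isUnit_repr_zero` applies to `b` or to
`b` with its two vectors swapped. [folklore] -/
theorem exists_basis_eq_of_not_dvd {ℓ : ℕ} [Fact ℓ.Prime] {N : Type*} [AddCommGroup N]
    [Module ℤ_[ℓ] N] (b : Module.Basis (Fin 2) ℤ_[ℓ] N) (t : N)
    (ht : ¬ ∃ s : N, (ℓ : ℤ_[ℓ]) • s = t) : ∃ e : Module.Basis (Fin 2) ℤ_[ℓ] N, e 0 = t := by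
  by_cases h0 : IsUnit (b.repr t 0)
  · obtain ⟨e, he, -⟩ := exists_basis_eq_of_isUnit_repr_zero b t h0
    exact ⟨e, he⟩
  by_cases h1 : IsUnit (b.repr t 1)
  · have h1' : IsUnit ((b.reindex (Equiv.swap 0 1)).repr t 0) := by
      rw [Module.Basis.repr_reindex_apply]
      exact h1
    obtain ⟨e, he, -⟩ := exists_basis_eq_of_isUnit_repr_zero (b.reindex (Equiv.swap 0 1)) t h1'
    exact ⟨e, he⟩
  -- both coordinates are divisible by `ℓ`: then `t ∈ ℓ N`
  exfalso
  rw [PadicInt.isUnit_iff] at h0 h1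
  have hlt0 : ‖b.repr t 0‖ < 1 := lt_of_le_of_ne (PadicInt.norm_le_one _) h0
  have hlt1 : ‖b.repr t 1‖ < 1 := lt_of_le_of_ne (PadicInt.norm_le_one _) h1
  obtain ⟨x, hx⟩ := (PadicInt.norm_lt_one_iff_dvd _).mp hlt0
  obtain ⟨y, hy⟩ := (PadicInt.norm_lt_one_iff_dvd _).mp hlt1
  apply ht
  refine ⟨x • b 0 + y • b 1, ?_⟩
  conv_rhs => rw [← b.sum_repr t]
  rw [Fin.sum_univ_two, hx, hy, smul_add, smul_smul, smul_smul]

end Basis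

/-! ### The Tate module: kernel of the reduction `T_ℓ → A[ℓ]`, adapted bases -/

section Tate

variable {A : Type u} [AddCommGroup A] {ℓ : ℕ} [Fact ℓ.Prime]

/-- `ker (T_ℓ A → A[ℓ]) ⊆ ℓ T_ℓ A` (`TateModule.p_smul_div`), in existential form. [folklore] -/
theorem exists_smul_eq_of_proj_one_eq_zero {m : TateModule A ℓ} (hm : proj ℓ 1 m = 0) :
    ∃ s : TateModule A ℓ, (ℓ : ℤ_[ℓ]) • s = m :=
  ⟨div m hm, p_smul_div m hm⟩

/-- `ℓ T_ℓ A ⊆ ker (T_ℓ A → A[ℓ])`: the first component of `ℓ • s` vanishes. [folklore] -/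
theorem proj_one_natCast_smul_eq_zero (s : TateModule A ℓ) : proj ℓ 1 ((ℓ : ℤ_[ℓ]) • s) = 0 := by
  rw [proj_natCast_smul]
  have h := pow_smul_proj 1 s
  rwa [pow_one] at h

/-- **Coordinates of an element of `ker (T_ℓ A → A[ℓ])` are divisible by `ℓ`**: in any
`ℤ_ℓ`-basis `e` of `T_ℓ A`, if `proj₁ m = 0` then every coordinate of `m` has norm `< 1`. [folklore] -/
theorem norm_repr_lt_one_of_proj_one_eq_zero {ι : Type*} (e : Module.Basis ι ℤ_[ℓ] (TateModule A ℓ))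
    {m : TateModule A ℓ} (hm : proj ℓ 1 m = 0) (i : ι) : ‖e.repr m i‖ < 1 := by
  obtain ⟨s, rfl⟩ := exists_smul_eq_of_proj_one_eq_zero hm
  rw [map_smul, Finsupp.smul_apply, smul_eq_mul, PadicInt.norm_lt_one_iff_dvd]
  exact dvd_mul_right _ _

end Tate

/-! ### Elliptic curves: a basis of `T_ℓ E` whose first vector lifts a point of order `ℓ` -/

section Elliptic

variable {K : Type u} [Field K] (W : WeierstrassCurve K) (ℓ : ℕ) [Fact ℓ.Prime]

open WeierstrassCurve

/-- **A basis of `T_ℓ E` adapted to a point of order `ℓ`.**  For `E` elliptic over `K` with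
`ℓ ≠ 0` in `K` and `P ∈ E[ℓ] ∖ {O}` (a geometric point), there is a `ℤ_ℓ`-basis `(e₀, e₁)` of
`T_ℓ E` with `proj₁ e₀ = P`: `T_ℓ E` is free of rank `2` (`module_free_tateModule_holds`,
`finrank_tateModule_eq_two_holds`, Silverman III.7.1), `P` lifts (`proj_surjective_of_isAlgClosed_holds`)
to some `t ∉ ℓ T_ℓ E`, and `t` extends to a basis (`exists_basis_eq_of_not_dvd`).
[cite: SilvermanAEC2009, Prop. III.7.1] -/
theorem exists_basis_proj_one_eq [W.IsElliptic] (hℓ : (ℓ : K) ≠ 0) {P : geomPoints W}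
    (hP : P ∈ geomTorsion W ℓ) (hP0 : P ≠ 0) :
    ∃ e : Module.Basis (Fin 2) ℤ_[ℓ] (W.tateModule ℓ), proj ℓ 1 (e 0) = P := by
  haveI := module_free_tateModule_holds W ℓ
  haveI := module_finite_tateModule_holds W ℓ
  let b : Module.Basis (Fin 2) ℤ_[ℓ] (W.tateModule ℓ) :=
    Module.finBasisOfFinrankEq ℤ_[ℓ] (W.tateModule ℓ) (finrank_tateModule_eq_two_holds W ℓ hℓ)
  have hP' : P ∈ geomTorsion W ((ℓ ^ 1 : ℕ) : ℤ) := by rwa [pow_one]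
  obtain ⟨t, ht⟩ := proj_surjective_of_isAlgClosed_holds W ℓ 1 hP'
  have hnot : ¬ ∃ s : W.tateModule ℓ, (ℓ : ℤ_[ℓ]) • s = t := by
    rintro ⟨s, rfl⟩
    exact hP0 (ht ▸ proj_one_natCast_smul_eq_zero s)
  obtain ⟨e, he⟩ := exists_basis_eq_of_not_dvd b t hnot
  exact ⟨e, by rw [he, ht]⟩

/-- Components of the Galois action on `T_ℓ E`: `projₙ (σ · a) = σ • projₙ a`. [folklore] -/
theorem proj_galoisRepTate (σ : Field.absoluteGaloisGroup K) (a : W.tateModule ℓ) (n : ℕ) :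
    proj ℓ n (W.galoisRepTate ℓ σ a) = σ • proj ℓ n a := by
  rw [galoisRepTate_apply_apply, proj_smul_of_distribMulAction]

/-- **Residual shape of the matrices in an adapted basis, I (the stable line).**  Let `e` be a
`ℤ_ℓ`-basis of `T_ℓ E` with `proj₁ e₀ = P` and let `σ` stabilise the line of `P`: `σ • P = a • P`
(`a ∈ ℕ`).  Then the `e₁`-coordinate of `σ e₀` has norm `< 1` (the matrix of `σ` is upper
triangular mod `ℓ`) and its `e₀`-coordinate is `≡ a (mod ℓ)`. [folklore] -/
theorem norm_repr_lt_one_of_smul_proj_eq (e : Module.Basis (Fin 2) ℤ_[ℓ] (W.tateModule ℓ))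
    {P : geomPoints W} (he : proj ℓ 1 (e 0) = P) {σ : Field.absoluteGaloisGroup K} {a : ℕ}
    (hσ : σ • P = a • P) :
    ‖e.repr (W.galoisRepTate ℓ σ (e 0)) 1‖ < 1 ∧
      ‖e.repr (W.galoisRepTate ℓ σ (e 0)) 0 - (a : ℤ_[ℓ])‖ < 1 := by
  have hm : proj ℓ 1 (W.galoisRepTate ℓ σ (e 0) - (a : ℤ_[ℓ]) • e 0) = 0 := by
    rw [map_sub, proj_galoisRepTate, proj_natCast_smul, he, hσ, sub_self]
  have h1 := norm_repr_lt_one_of_proj_one_eq_zero e hm 1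
  have h0 := norm_repr_lt_one_of_proj_one_eq_zero e hm 0
  simp only [map_sub, map_smul, Finsupp.coe_sub, Finsupp.coe_smul, Pi.sub_apply, Pi.smul_apply,
    Module.Basis.repr_self, Finsupp.single_apply, smul_eq_mul] at h1 h0
  norm_num at h1 h0
  exact ⟨h1, h0⟩

/-- **Residual shape of the matrices in an adapted basis, II (the quotient).**  With `e` as above,
if `σ` acts on `P₁ = proj₁ e₁` through the quotient `E[ℓ]/⟨P⟩` as the identity,
`σ • P₁ - P₁ = a • P`, then the `e₁`-coordinate of `σ e₁` is `≡ 1 (mod ℓ)`. [folklore] -/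
theorem norm_repr_sub_one_lt_one_of_smul_proj_sub (e : Module.Basis (Fin 2) ℤ_[ℓ] (W.tateModule ℓ))
    {P : geomPoints W} (he : proj ℓ 1 (e 0) = P) {σ : Field.absoluteGaloisGroup K} {a : ℕ}
    (hσ : σ • proj ℓ 1 (e 1) - proj ℓ 1 (e 1) = a • P) :
    ‖e.repr (W.galoisRepTate ℓ σ (e 1)) 1 - 1‖ < 1 := by
  have hm : proj ℓ 1 (W.galoisRepTate ℓ σ (e 1) - e 1 - (a : ℤ_[ℓ]) • e 0) = 0 := by
    rw [map_sub, map_sub, proj_galoisRepTate, proj_natCast_smul, he, hσ, sub_self]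
  have h1 := norm_repr_lt_one_of_proj_one_eq_zero e hm 1
  simp only [map_sub, map_smul, Finsupp.coe_sub, Finsupp.coe_smul, Pi.sub_apply, Pi.smul_apply,
    Module.Basis.repr_self, Finsupp.single_apply, smul_eq_mul] at h1
  norm_num at h1
  exact h1

/-- **Residual shape, III (a fixed point).**  If `σ • P = P` then the `e₀`-coordinate of `σ e₀` is
`≡ 1 (mod ℓ)` (case `a = 1` of `norm_repr_lt_one_of_smul_proj_eq`). [folklore] -/
theorem norm_repr_sub_one_lt_one_of_smul_proj_eq_self (e : Module.Basis (Fin 2) ℤ_[ℓ] (W.tateModule ℓ))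
    {P : geomPoints W} (he : proj ℓ 1 (e 0) = P) {σ : Field.absoluteGaloisGroup K}
    (hσ : σ • P = P) : ‖e.repr (W.galoisRepTate ℓ σ (e 0)) 0 - 1‖ < 1 := by
  have h := (norm_repr_lt_one_of_smul_proj_eq W ℓ e he (a := 1) (by rw [hσ, one_smul])).2
  rwa [Nat.cast_one] at h

end Elliptic

end Summit.Langlands.Langlands.Theorems.FiveIsogenyEllipticCurves

end
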